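import Summits.ResolutionOfSingularities.ResolutionOfSingularities.Theorems.PurelyInseparableDim4RidgeResidual
import Summits.ResolutionOfSingularities.ResolutionOfSingularities.Theorems.PurelyInseparableDim4IsolatedChainBaseChange
import Literature.AlgebraicGeometry.Resolution.PointBlowupDirectrixBaseChange
import Literature.AlgebraicGeometry.Resolution.OrdZeroBasics
import Mathlib.FieldTheory.IsAlgClosed.AlgebraicClosure
import HarnessLib

/-!
# `NoWideTrap p q` MAY BE CHECKED OVER ALGEBRAICALLY CLOSED FIELDS: wide / cone-two isolated chains go up (cell `res-dim4-pi`)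

[OURS · counted 0 · AI work weaker than expert review.]  Cell `res-dim4-pi` (D-0157 DOOR 2), seat res-dim4-p-1 g2; desk
WORD #66 (the p-program «`NoWideTrap p p` ⟸ CJS Thm 6.40 (F-111) for every prime `p ≥ 3`»), holder res-dim4-p-2 g2's scope
item (c3) «base change».  NOTHING here proves CJS Thm 6.40, `NoWideTrap p p`, K2(p) = `NoAboveFloorTrap p p`, or resolution
of singularities in dimension ≥ 4 / characteristic `p`.

The E2(p,p) dictionary concludes, from CJS Thm 6.40, that no ALGEBRAICALLY CLOSED field of characteristic `p` carries an
infinite isolated CONE-TWO chain (`IsIsolated p`, `Step0 p`, `ord₀ = p`, `ē = 2` throughout).  This file is the base change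
that turns that conclusion into `RidgeBudget.NoWideTrap p p` (all fields of characteristic `p`, `ē ≥ 2`), in the manner of
res-dim4-p-14's `IsolatedChainBaseChange.noIsolatedTrap_of_forall_isAlgClosed` for F4-I:

* `ebar_map` — **`ē(F ⊗_K L) = ē(F)`** for any field map `f : K →+* L` (`RidgeBudget.ebar` = `dim A(in F)`; the tree's
  `PointBlowup.finrank_additiveSubspace_map` [CJS Lemma 2.20 (2)] and `initialForm_map`);
* `ordZero_map_ringHom` — `ord₀ (F ⊗_K L) = ord₀ F` (`ordZero_map_of_injective`);
* `wideChain_map`, `coneTwoChain_map` — wide (`ord₀ = q`, `2 ≤ ē`) and cone-two (`ord₀ = q`, `ē = 2`) isolated `Step0 q`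
  chains go up along `f` (isolation and `Step0` by `IsolatedChainBaseChange.isolatedChain_map`);
* `coneTwo_tail_of_wide` — over one field: the shift `k ↦ k + 1` of a wide isolated `Step0 p` chain is a cone-two chain
  (`ebar_succ_le_two`: clean floor states have `ē ≤ 2`);
* **`noWideTrap_of_forall_isAlgClosed (p q)`** — if no algebraically closed field of characteristic `p` carries an infinite
  wide isolated chain, then `NoWideTrap p q`;
* **`noWideTrap_of_forall_isAlgClosed_coneTwo (p) [Fact p.Prime]`** — if no algebraically closed field of characteristic
  `p` carries an infinite isolated CONE-TWO chain, then `NoWideTrap p p`; and the `PerfectField` forms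
  `noWideTrap_of_forall_perfectField[_coneTwo]` (the binder shape of the dictionary rows).

bears_on: LADDER-RESOLUTION:D157-DOOR2 (res-dim4-pi · F4-I(p,p) · E2(p,p) dictionary, base change (c3)).
Supports stmt-ResolutionOfSingularities-16155 (helper).
-/

set_option linter.dupNamespace false

noncomputable section

open MvPolynomial
open Literature.AlgebraicGeometry.Resolution
open Literature.AlgebraicGeometry.Resolution.Hauser2010
open Literature.AlgebraicGeometry.Resolution.HauserPerlega2019

namespace Summit.ResolutionOfSingularities.ResolutionOfSingularities.Theorems.PIDim4

namespace RidgeBudget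

/-! ## 1. The letters under base change -/

/-- **`ē(F ⊗_K L) = ē(F)`**: the directrix letter `ebar F = dim_K A(in F)` is invariant under any homomorphism of fields
(`in (F ⊗ 1) = (in F) ⊗ 1` and `dim_L A(Φ ⊗ 1) = dim_K A(Φ)`). [cite: CossartJannsenSaito2020, Lemma 2.20 (2) and Def. 2.21] -/
theorem ebar_map {K L : Type} [Field K] [Field L] (f : K →+* L) (F : MvPolynomial (Fin 4) K) :
    ebar (MvPolynomial.map f F) = ebar F := by
  letI : Algebra K L := f.toAlgebra
  unfold ebar
  rw [show f = algebraMap K L from rfl, HauserPerlega2019.initialForm_map]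
  exact PointBlowup.finrank_additiveSubspace_map (K := K) (K' := L) (initialForm F)

/-- `ord₀ (F ⊗_K L) = ord₀ F` for a homomorphism of fields. [cite: ZariskiSamuel1960, Vol. II Ch. VII §1 p.129] -/
theorem ordZero_map_ringHom {K L : Type} [Field K] [Field L] (f : K →+* L) (F : MvPolynomial (Fin 4) K) :
    ordZero (MvPolynomial.map f F) = ordZero F :=
  ordZero_map_of_injective f.injective F

/-! ## 2. Wide and cone-two chains go up -/

/-- **Wide isolated chains go up**: the image along `f : K →+* L` of an isolated `Step0 q` chain with `ord₀ = q` and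
`2 ≤ ē` throughout is again such a chain. [folklore] -/
theorem wideChain_map {K L : Type} [Field K] [Field L] [DecidableEq K] [DecidableEq L] (f : K →+* L) {q : ℕ}
    {c : ℕ → State K}
    (hc : ∀ k, IsIsolated q (c k).F ∧ Step0 q (c k) (c (k + 1)) ∧ ordZero (c k).F = q ∧ 2 ≤ ebar (c k).F) :
    ∀ k, IsIsolated q ((⟨MvPolynomial.map f (c k).F, (c k).r, (c k).exc⟩ : State L)).F ∧
      Step0 q (⟨MvPolynomial.map f (c k).F, (c k).r, (c k).exc⟩ : State L)
        ⟨MvPolynomial.map f (c (k + 1)).F, (c (k + 1)).r, (c (k + 1)).exc⟩ ∧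
      ordZero ((⟨MvPolynomial.map f (c k).F, (c k).r, (c k).exc⟩ : State L)).F = q ∧
      2 ≤ ebar ((⟨MvPolynomial.map f (c k).F, (c k).r, (c k).exc⟩ : State L)).F := by
  have hmap := IsolatedChainBaseChange.isolatedChain_map f (fun k => ⟨(hc k).1, (hc k).2.1⟩)
  intro k
  refine ⟨(hmap k).1, (hmap k).2, ?_, ?_⟩
  · show ordZero (MvPolynomial.map f (c k).F) = q
    rw [ordZero_map_ringHom, (hc k).2.2.1]
  · show 2 ≤ ebar (MvPolynomial.map f (c k).F)
    rw [ebar_map]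
    exact (hc k).2.2.2

/-- **Cone-two isolated chains go up**: the image along `f : K →+* L` of an isolated `Step0 q` chain with `ord₀ = q` and
`ē = 2` throughout is again such a chain. [folklore] -/
theorem coneTwoChain_map {K L : Type} [Field K] [Field L] [DecidableEq K] [DecidableEq L] (f : K →+* L) {q : ℕ}
    {c : ℕ → State K}
    (hc : ∀ k, IsIsolated q (c k).F ∧ Step0 q (c k) (c (k + 1)) ∧ ordZero (c k).F = q ∧ ebar (c k).F = 2) :
    ∀ k, IsIsolated q ((⟨MvPolynomial.map f (c k).F, (c k).r, (c k).exc⟩ : State L)).F ∧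
      Step0 q (⟨MvPolynomial.map f (c k).F, (c k).r, (c k).exc⟩ : State L)
        ⟨MvPolynomial.map f (c (k + 1)).F, (c (k + 1)).r, (c (k + 1)).exc⟩ ∧
      ordZero ((⟨MvPolynomial.map f (c k).F, (c k).r, (c k).exc⟩ : State L)).F = q ∧
      ebar ((⟨MvPolynomial.map f (c k).F, (c k).r, (c k).exc⟩ : State L)).F = 2 := by
  have hmap := IsolatedChainBaseChange.isolatedChain_map f (fun k => ⟨(hc k).1, (hc k).2.1⟩)
  intro k
  refine ⟨(hmap k).1, (hmap k).2, ?_, ?_⟩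
  · show ordZero (MvPolynomial.map f (c k).F) = q
    rw [ordZero_map_ringHom, (hc k).2.2.1]
  · show ebar (MvPolynomial.map f (c k).F) = 2
    rw [ebar_map, (hc k).2.2.2]

/-- **Over one field, a wide chain has a cone-two tail**: along an isolated `Step0 p` chain with `ord₀ = p` and `2 ≤ ē`
throughout (`p` prime), every state of index `k + 1` is clean, hence has `ē ≤ 2`, so the shifted chain is a cone-two
chain. [OURS · frame reading] [folklore] -/
theorem coneTwo_tail_of_wide (p : ℕ) [Fact p.Prime] {K : Type} [Field K] [CharP K p] [DecidableEq K]
    {c : ℕ → State K}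
    (hc : ∀ k, IsIsolated p (c k).F ∧ Step0 p (c k) (c (k + 1)) ∧ ordZero (c k).F = p ∧ 2 ≤ ebar (c k).F) :
    ∀ k, IsIsolated p (c (k + 1)).F ∧ Step0 p (c (k + 1)) (c (k + 1 + 1)) ∧ ordZero (c (k + 1)).F = p ∧
      ebar (c (k + 1)).F = 2 := fun k =>
  ⟨(hc (k + 1)).1, (hc (k + 1)).2.1, (hc (k + 1)).2.2.1,
    le_antisymm (ebar_succ_le_two p (fun k => (hc k).2.1) k (hc (k + 1)).2.2.1) (hc (k + 1)).2.2.2⟩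

/-! ## 3. `NoWideTrap` over algebraically closed / perfect fields suffices -/

/-- **`NoWideTrap p q` may be checked over ALGEBRAICALLY CLOSED fields**: if no algebraically closed field of
characteristic `p` carries an infinite wide isolated `Step0 q` chain, then `NoWideTrap p q` (extend a chain over `K` to
`K̄`). [folklore] -/
theorem noWideTrap_of_forall_isAlgClosed (p q : ℕ)
    (h : ∀ (L : Type) [Field L] [IsAlgClosed L] [CharP L p] [DecidableEq L],
      ¬ ∃ c : ℕ → State L, ∀ k, IsIsolated q (c k).F ∧ Step0 q (c k) (c (k + 1)) ∧
        ordZero (c k).F = q ∧ 2 ≤ ebar (c k).F) :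
    NoWideTrap p q := by
  intro K _ _ _
  rintro ⟨c, hc⟩
  letI : DecidableEq (AlgebraicClosure K) := Classical.decEq _
  exact h (AlgebraicClosure K) ⟨_, wideChain_map (algebraMap K (AlgebraicClosure K)) hc⟩

/-- **`NoWideTrap p p` from the CONE-TWO statement over ALGEBRAICALLY CLOSED fields** (`p` prime): if no algebraically
closed field of characteristic `p` carries an infinite isolated `Step0 p` chain with `ord₀ = p` and `ē = 2` throughout,
then `NoWideTrap p p` (extend to `K̄`, then shift by one index). [folklore] -/
theorem noWideTrap_of_forall_isAlgClosed_coneTwo (p : ℕ) [Fact p.Prime]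
    (h : ∀ (L : Type) [Field L] [IsAlgClosed L] [CharP L p] [DecidableEq L],
      ¬ ∃ c : ℕ → State L, ∀ k, IsIsolated p (c k).F ∧ Step0 p (c k) (c (k + 1)) ∧
        ordZero (c k).F = p ∧ ebar (c k).F = 2) :
    NoWideTrap p p := by
  refine noWideTrap_of_forall_isAlgClosed p p fun L _ _ _ _ => ?_
  rintro ⟨c, hc⟩
  exact h L ⟨fun k => c (k + 1), coneTwo_tail_of_wide p hc⟩

/-- **`NoWideTrap p q` may be checked over PERFECT fields** (the binder shape of the dictionary rows). [folklore] -/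
theorem noWideTrap_of_forall_perfectField (p q : ℕ)
    (h : ∀ (L : Type) [Field L] [CharP L p] [PerfectField L] [DecidableEq L],
      ¬ ∃ c : ℕ → State L, ∀ k, IsIsolated q (c k).F ∧ Step0 q (c k) (c (k + 1)) ∧
        ordZero (c k).F = q ∧ 2 ≤ ebar (c k).F) :
    NoWideTrap p q :=
  noWideTrap_of_forall_isAlgClosed p q fun L _ _ _ _ => h L

/-- **`NoWideTrap p p` from the cone-two statement over PERFECT fields** (`p` prime). [folklore] -/
theorem noWideTrap_of_forall_perfectField_coneTwo (p : ℕ) [Fact p.Prime]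
    (h : ∀ (L : Type) [Field L] [CharP L p] [PerfectField L] [DecidableEq L],
      ¬ ∃ c : ℕ → State L, ∀ k, IsIsolated p (c k).F ∧ Step0 p (c k) (c (k + 1)) ∧
        ordZero (c k).F = p ∧ ebar (c k).F = 2) :
    NoWideTrap p p :=
  noWideTrap_of_forall_isAlgClosed_coneTwo p fun L _ _ _ _ => h L

end RidgeBudget

end Summit.ResolutionOfSingularities.ResolutionOfSingularities.Theorems.PIDim4

end
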